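import Literature.MathematicalPhysics.QuantumFieldTheory.Balaban1983to89.B6CubeMoutV1

/-!
# `Balaban1983to89.B6OpTransposeV1` — T. Bałaban, *Propagators and renormalization transformations for lattice gauge theories. II*,
# Commun. Math. Phys. **96** (1984) 223–250 [Balaban1984PropagatorsII], Prop. 2.6 (2.136) p. 247, the RIGHT-factor entry `|(G∇*J)(x)|`:
# THE TRANSPOSE CALCULUS that turns the cube identities of the left walk (2.91)/(2.141) (p38 gen 28–29: `hagree_cube`, `hinvl_cube`, `hdec_cube`,
# `outLoc_Ml_hB`) into the identities of the transposed walk `G₀Δ_a = I − R̃` (`…B6Eq291Transpose`) — every operator of the construction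
# (`Δ_a`, `G`, `G_□`, `M_□`, `P_□`, the averaging part, the bond differences) is symmetric or has a named transpose

statement-level skeleton of published theorems with citation tags; proofs where landed; nothing here is a claim about the Yang–Mills mass gap

PDF held: `paper:balaban1984-cmp96-propagators-rt-ii` (journal page = PDF page + 222); p. 225 [PDF 3] ((2.14): «the operator Q′*aQ′ is given by the
quadratic form ⟨λ, Q′*aQ′λ⟩ = Σ_{j=0}^k Σ_{y∈Λ_j} a_j(Lʲη)^{d−2}|(Q′_jλ)(y)|²» — print's star convention), p. 226 [PDF 4] ((2.19) `Δ_a = ∂*∂ + ∂R∂* + Q*aQ`, «The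
operator Q*aQ is defined by a formula similar to (2.14)», (2.22) `G = Δ_a⁻¹`), p. 239 [PDF 17] ((2.90)–(2.93)), p. 247 [PDF 25] ((2.136), (2.141)) re-read
this generation on the ×2 renders `b2b-balaban-ref1/pages/1984-cmp96-propagators-rt-II/…-p003/p004/p017/p025-x2.png`.
v1.1 (doc-only, Lean byte-identical below the header; referee ref-4 D-g76-3): v1.0 quoted *"Of course Q′* is the adjoint operator"* as print p. 226 — that
sentence is NOT in print (cmp96 pp. 224–226 contain no «adjoint»); print's support for «Q*, ∂* are the adjoints» is the star convention of (2.14) p. 225 and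
(2.19)–(2.21) p. 226, now cited instead (three places).

CITATION HEADER (lean-in-tree rule) — WHAT IS REPRODUCED.  Phase-2 file of the `lit-balaban` typed skeleton (HOME `run/shared/lean/pub/lit-balaban/`), seat
**p38 gen 31**, brick 5 of the programme «(2.136)₃ by the transposed walk» (bricks 1–4: `…B6Prop26RightChainGeneric`, `…B6Eq291Transpose`,
`…B6Ineq2134TransposeDiag`, `…B6Ineq2134TransposeKLevelTorus`); SKELETON rows B6.Eq2.91 × B6.Eq2.92 × B6.Eq2.19–2.22 × B6.Prop2.6 (cells only; decls of
record untouched).  Print's operators are symmetric: `Δ_a = ∂*∂ + ∂R∂* + Q*aQ` with `∂*`, `Q*` the adjoints (star convention, (2.14) p. 225, (2.19) p. 226)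
and `R` an orthogonal projection ((2.17), (2.26)), `G = Δ_a⁻¹` (2.22), the `T_□`-operators `Δ_□ + Q*a_□Q`, `∂P_□∂*`, `G_□` likewise (2.90); hence the transposed resolvent identity and the transposed cube
identities hold.  THIS FILE makes that precise in the tree's language of operators of bond FUNCTIONS (`Module.End ℝ (X → ℝ)`, `X` finite):
* §1 **`tr`** — the transpose (`Matrix.toLin' (LinearMap.toMatrix' T)ᵀ`), characterised by **`dot_tr`** `⟨tr T f, g⟩ = ⟨f, T g⟩` (`Matrix.dotProduct`) and
  **`tr_unique`**; `tr_mul` (order reversed), `tr_add/sub/neg/smul/sum/one/zero`, `tr_tr`, **`tr_mulOp`** (multiplications are symmetric),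
  **`inLoc_tr_of_outLoc`** / `outLoc_tr_of_inLoc` (input and output localisation are exchanged), **`tr_transplant`** (`tr (εX′ρ) = ε(tr X′)ρ` for ANY
  window and chart: `ρ` and `ε` are mutual transposes);
* §2 `ℓ²`: **`dot_onFun`** (`⟨f, onFun T g⟩ = ⟪f, Tg⟫_{ℓ²}`), **`tr_onFun`** (`tr (onFun T) = onFun T†`, Mathlib's `LinearMap.adjoint`), `tr_onFun_of_symm`;
* §3 the torus translations: **`tr_TB`** (`tr τ_a = τ_{−a}`), `tr_conj`;
* §4 THE CUBE: `tr_GlC/MlC/PlC`, **`tr_Gl`**, **`tr_Ml`**, **`tr_Pl`**, **`tr_NC`** (all symmetric: p22's `G_symm`, `deltaA`-type symmetry of `Δ_□ + Q*a_□Q` and of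
  `∂P_□∂*` from `IsLattice.grad_adj`, `a_symm`, the orthogonal projection `R`), **`tr_EC`** (`tr E_{(λ,±)} = E_{(λ,∓)}`: `∇_λ† = ∇_λ*`, p02's `adjoint_Dop`),
  `tr_onFun_localPart` (the global `∂*∂ + ∂∂* + Q*aQ`), `tr_onFun_Dg` (`∂(1 − R)∂*`);
* §5 THE TRANSPOSED CUBE IDENTITIES: **`hagreeT_cube`** (`h_□·M = h_□·M_□`), **`hinvT_cube`** (`h_□G_□(M_□ − P_□) = h_□`), **`hdecT_cube`**
  (`M_□h_□ − h_□M_□ = (Σ_e E_ē·c_e − c₀) + Σ_k (h_□N − Nh_□)·z` — p38 gen 29's `hdec_cube` transposed, `ē = (λ, ∓)`), **`inLoc_hB_Ml`** (`InLoc (h_□M_□) □̃` from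
  p38's `outLoc_Ml_hB`), `onFun_deltaAE_mul_GE` (`Δ_aG = 1`, the left inverse the transposed walk starts from).
DEFINITION (`tr`) + THEOREMS, all proved, 0 sorry, no `def … : Prop`; standard axioms.

HONEST SCOPE / DIVERGENCES.  (1) `tr` is the transpose for the DOT product of bond functions (lattice units; print's `ℓ²` pairing (2.69) up to the uniform
factor `η^d`), which is what the block-majorant bookkeeping needs; no weighted adjoint is introduced.  (2) Nothing analytic: this file moves identities, not
estimates (block majorants do NOT transpose — the reason for the whole programme, see `…B6Prop26RightChainGeneric`).  (3) The symmetry of the two-scale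
`G_□` uses the member's lattice/positivity structure (`B6SectCTwoScaleV1Lattice.isLattice/positive`, `a₀ > 0`).  Nothing on d = 4 or the continuum; NOT
summit progress.  Unit `lit-balaban-p38` (gen 31), 2026-08-23.
-/

noncomputable section

open scoped BigOperators InnerProductSpace
open Finset Matrix

namespace Literature.MathematicalPhysics.QuantumFieldTheory.Balaban1983to89.B6OpTransposeV1

open B6Prop26Gluing (mulOp mulOp_apply OutLoc InLoc)
open B6RandomWalk (BlockSupp)
open B6Prop26ReachTransplant (transplant restrictOp extendOp restrictOp_apply extendOp_apply)
open B6Ineq2133TwoScaleV1 (onFun onFun_apply)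

/-! ## §1  The transpose of an operator of functions on a finite set -/

section Generic

variable {X : Type} [Fintype X] [DecidableEq X]

/-- **THE TRANSPOSE** of an operator of the functions on a finite set (matrix transpose in the canonical basis).
[cite: Balaban1984PropagatorsII, (2.14) p.225 and (2.19) p.226 (star convention: `Q*`, `∂*` the adjoints), (2.69) p.235, dictionary] -/
def tr (T : Module.End ℝ (X → ℝ)) : Module.End ℝ (X → ℝ) := Matrix.toLin' (LinearMap.toMatrix' T)ᵀ

/-- `tr T f = f ᵥ* [T]`. [cite: Balaban1984PropagatorsII, (2.69) p.235, dictionary] -/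
theorem tr_apply_eq (T : Module.End ℝ (X → ℝ)) (f : X → ℝ) : tr T f = Matrix.vecMul f (LinearMap.toMatrix' T) := by
  rw [tr, Matrix.toLin'_apply, Matrix.mulVec_transpose]

/-- `T g = [T] *ᵥ g`. [cite: Balaban1984PropagatorsII, (2.69) p.235, dictionary] -/
theorem apply_eq_mulVec (T : Module.End ℝ (X → ℝ)) (g : X → ℝ) : T g = Matrix.mulVec (LinearMap.toMatrix' T) g := by
  conv_lhs => rw [← Matrix.toLin'_toMatrix' T]
  rw [Matrix.toLin'_apply]

/-- **THE DEFINING IDENTITY `⟨tr T f, g⟩ = ⟨f, T g⟩`** (dot product of functions). [cite: Balaban1984PropagatorsII, (2.18) p.226, (2.69) p.235] -/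
theorem dot_tr (T : Module.End ℝ (X → ℝ)) (f g : X → ℝ) : dotProduct (tr T f) g = dotProduct f (T g) := by
  rw [tr_apply_eq, apply_eq_mulVec, Matrix.dotProduct_mulVec]

/-- functions with equal dot products against everything are equal. [cite: Balaban1984PropagatorsII, (2.69) p.235, bookkeeping] -/
theorem eq_of_dot (u v : X → ℝ) (h : ∀ g, dotProduct u g = dotProduct v g) : u = v := by
  funext x
  have := h (Pi.single x 1)
  simpa [dotProduct, Pi.single_apply] using this

/-- **UNIQUENESS**: an operator `S` with `⟨S f, g⟩ = ⟨f, T g⟩` for all `f, g` IS `tr T`. [cite: Balaban1984PropagatorsII, (2.18) p.226, bookkeeping] -/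
theorem tr_unique {S T : Module.End ℝ (X → ℝ)} (h : ∀ f g, dotProduct (S f) g = dotProduct f (T g)) : S = tr T := by
  apply LinearMap.ext; intro f
  exact eq_of_dot _ _ fun g => by rw [h, dot_tr]

/-- `tr (AB) = tr B · tr A`. [cite: Balaban1984PropagatorsII, (2.91) p.239 (products reversed), bookkeeping] -/
theorem tr_mul (A B : Module.End ℝ (X → ℝ)) : tr (A * B) = tr B * tr A := by
  symm; apply tr_unique; intro f g
  rw [Module.End.mul_apply, dot_tr, dot_tr, Module.End.mul_apply]

/-- `tr (A + B) = tr A + tr B`. [cite: Balaban1984PropagatorsII, (2.91) p.239, bookkeeping] -/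
theorem tr_add (A B : Module.End ℝ (X → ℝ)) : tr (A + B) = tr A + tr B := by
  simp [tr, Matrix.transpose_add, map_add]

/-- `tr (A − B) = tr A − tr B`. [cite: Balaban1984PropagatorsII, (2.91) p.239, bookkeeping] -/
theorem tr_sub (A B : Module.End ℝ (X → ℝ)) : tr (A - B) = tr A - tr B := by
  simp [tr, Matrix.transpose_sub, map_sub]

/-- `tr (−A) = −tr A`. [cite: Balaban1984PropagatorsII, (2.91) p.239, bookkeeping] -/
theorem tr_neg (A : Module.End ℝ (X → ℝ)) : tr (-A) = -tr A := by
  simp [tr, Matrix.transpose_neg, map_neg]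

/-- `tr (s•A) = s•tr A`. [cite: Balaban1984PropagatorsII, (2.94) p.239, bookkeeping] -/
theorem tr_smul (s : ℝ) (A : Module.End ℝ (X → ℝ)) : tr (s • A) = s • tr A := by
  simp [tr, Matrix.transpose_smul, map_smul]

/-- `tr 1 = 1`. [cite: Balaban1984PropagatorsII, (2.91) p.239, bookkeeping] -/
theorem tr_one : tr (1 : Module.End ℝ (X → ℝ)) = 1 := by
  symm; apply tr_unique; intro f g; simp

/-- `tr 0 = 0`. [cite: Balaban1984PropagatorsII, (2.91) p.239, bookkeeping] -/
theorem tr_zero : tr (0 : Module.End ℝ (X → ℝ)) = 0 := by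
  simp [tr]

/-- `tr (tr A) = A`. [cite: Balaban1984PropagatorsII, (2.18) p.226, bookkeeping] -/
theorem tr_tr (A : Module.End ℝ (X → ℝ)) : tr (tr A) = A := by
  symm; apply tr_unique; intro f g
  rw [dotProduct_comm f, dot_tr, dotProduct_comm]

/-- `tr` of a finite sum. [cite: Balaban1984PropagatorsII, (2.91) p.239, bookkeeping] -/
theorem tr_sum {ι : Type} (s : Finset ι) (A : ι → Module.End ℝ (X → ℝ)) : tr (∑ i ∈ s, A i) = ∑ i ∈ s, tr (A i) := by
  simp [tr, Matrix.transpose_sum, map_sum]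

/-- `tr` is injective. [cite: Balaban1984PropagatorsII, (2.18) p.226, bookkeeping] -/
theorem tr_injective {A B : Module.End ℝ (X → ℝ)} (h : tr A = tr B) : A = B := by
  rw [← tr_tr A, h, tr_tr]

/-- **MULTIPLICATION OPERATORS ARE SYMMETRIC**: `tr (h·) = (h·)`. [cite: Balaban1984PropagatorsII, (2.91)–(2.92) p.239 (h_□, ζ_□), bookkeeping] -/
theorem tr_mulOp (h : X → ℝ) : tr (mulOp h) = mulOp h := by
  symm; apply tr_unique; intro f g
  simp only [dotProduct, mulOp_apply]
  exact Finset.sum_congr rfl fun x _ => by ring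

/-- `⟨f, T g⟩` as a double sum of matrix entries is not needed; what is: the value of `tr T μ` at `x` is `⟨T δ_x, μ⟩`.
[cite: Balaban1984PropagatorsII, (2.69) p.235, bookkeeping] -/
theorem tr_apply_single (T : Module.End ℝ (X → ℝ)) (μ : X → ℝ) (x : X) : tr T μ x = dotProduct (T (Pi.single x 1)) μ := by
  have h := dot_tr T μ (Pi.single x 1)
  have e : dotProduct (tr T μ) (Pi.single x (1 : ℝ)) = tr T μ x := by
    simp [dotProduct, Pi.single_apply]
  rw [← e, h, dotProduct_comm]

/-- **OUTPUT LOCALISATION BECOMES INPUT LOCALISATION**: if `T` has its outputs over `U` (`OutLoc T U`), then `tr T` has its inputs over `U`.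
[cite: Balaban1984PropagatorsII, (2.91)–(2.93) p.239 (supp h_□, range of Δ), bookkeeping] -/
theorem inLoc_tr_of_outLoc {g : B6.Geometry} (blk : X → g.Site) {T : Module.End ℝ (X → ℝ)} {U : Set g.Site} (hT : OutLoc blk T U) :
    InLoc blk (tr T) U := by
  intro y' μ B hμ hy'
  funext x
  rw [tr_apply_single, Pi.zero_apply, dotProduct]
  refine Finset.sum_eq_zero fun x' _ => ?_
  by_cases hx' : blk x' = y'
  · rw [hT _ x' (hx' ▸ hy'), zero_mul]
  · rw [hμ.off x' hx', mul_zero]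

/-- … and conversely. [cite: Balaban1984PropagatorsII, (2.91)–(2.93) p.239, bookkeeping] -/
theorem outLoc_tr_of_inLoc {g : B6.Geometry} (blk : X → g.Site) {T : Module.End ℝ (X → ℝ)} {U : Set g.Site} (hT : InLoc blk T U) :
    OutLoc blk (tr T) U := by
  intro v x hx
  rw [tr_apply_single, dotProduct]
  have h0 : T (Pi.single x 1) = 0 :=
    hT (blk x) (Pi.single x 1) 1 ⟨zero_le_one, fun x' _ => by by_cases h : x' = x <;> simp [h], fun x' hx' => by
      rw [Pi.single_apply, if_neg]; intro h; exact hx' (h ▸ rfl)⟩ hx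
  simp [h0]

end Generic

/-! ### The transplant along a window: `ρ` and `ε` are mutual transposes -/

section Transplant

variable {X X' : Type} [Fintype X] [DecidableEq X] [Fintype X'] [DecidableEq X'] (W : Finset X) (e : X → X')

omit [Fintype X] [DecidableEq X] in
/-- the regrouping `Σ_{x∈W} f(x)F(e x) = Σ_{x′} (ρf)(x′)F(x′)` (no injectivity needed). [cite: Balaban1984PropagatorsII, p.238 (T_□), dictionary] -/
theorem sum_window_eq_dot_restrict (f : X → ℝ) (F : X' → ℝ) :
    ∑ x ∈ W, f x * F (e x) = dotProduct (restrictOp W e f) F := by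
  simp only [dotProduct, restrictOp_apply, Finset.sum_mul]
  rw [← Finset.sum_fiberwise_of_maps_to (g := e) (t := Finset.univ) (fun x _ => Finset.mem_univ (e x))]
  refine Finset.sum_congr rfl fun x' _ => Finset.sum_congr rfl fun x hx => ?_
  rw [(Finset.mem_filter.1 hx).2]

/-- `⟨f, (εX′ρ)g⟩ = ⟨ρf, X′(ρg)⟩`. [cite: Balaban1984PropagatorsII, (2.90)–(2.91) p.239, p.238 (T_□), dictionary] -/
theorem dot_transplant (T' : Module.End ℝ (X' → ℝ)) (f g : X → ℝ) :
    dotProduct f (transplant W e T' g) = dotProduct (restrictOp W e f) (T' (restrictOp W e g)) := by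
  rw [← sum_window_eq_dot_restrict]
  simp only [dotProduct, transplant, LinearMap.coe_comp, Function.comp_apply, extendOp_apply]
  rw [← Finset.sum_subset (Finset.subset_univ W)]
  · exact Finset.sum_congr rfl fun x hx => by rw [if_pos hx]
  · intro x _ hx; rw [if_neg hx, mul_zero]

/-- **`tr (εX′ρ) = ε(tr X′)ρ`** — transplanting commutes with transposition, for ANY window and chart.
[cite: Balaban1984PropagatorsII, (2.90)–(2.91) p.239, p.238 (T_□), dictionary] -/
theorem tr_transplant (T' : Module.End ℝ (X' → ℝ)) : tr (transplant W e T') = transplant W e (tr T') := by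
  symm; apply tr_unique; intro f g
  rw [dotProduct_comm, dot_transplant, dotProduct_comm, dot_tr, ← dot_transplant]

end Transplant

/-! ## §2  `ℓ²`: `tr (onFun T) = onFun T†` -/

section L2

variable {X : Type} [Fintype X] [DecidableEq X]

omit [DecidableEq X] in
/-- **`⟨f, onFun T g⟩ = ⟪f, Tg⟫_{ℓ²}`** (real `ℓ²`, canonical basis). [cite: Balaban1984PropagatorsII, (2.18) p.226, (2.69) p.235, dictionary] -/
theorem dot_onFun (T : EuclideanSpace ℝ X →ₗ[ℝ] EuclideanSpace ℝ X) (f g : X → ℝ) :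
    dotProduct f (onFun T g) = ⟪WithLp.toLp 2 f, T (WithLp.toLp 2 g)⟫_ℝ := by
  rw [PiLp.inner_apply, dotProduct]
  refine Finset.sum_congr rfl fun x _ => ?_
  rw [onFun_apply]
  simp [mul_comm]

/-- **`tr (onFun T) = onFun T†`**. [cite: Balaban1984PropagatorsII, (2.14) p.225, (2.19) p.226 (star convention), dictionary] -/
theorem tr_onFun (T : EuclideanSpace ℝ X →ₗ[ℝ] EuclideanSpace ℝ X) : tr (onFun T) = onFun (LinearMap.adjoint T) := by
  symm; apply tr_unique; intro f g
  rw [dotProduct_comm, dot_onFun, LinearMap.adjoint_inner_right, real_inner_comm, ← dot_onFun]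

/-- a symmetric `ℓ²` operator gives a symmetric operator of functions. [cite: Balaban1984PropagatorsII, (2.19)–(2.22) p.226, dictionary] -/
theorem tr_onFun_of_symm {T : EuclideanSpace ℝ X →ₗ[ℝ] EuclideanSpace ℝ X} (hT : ∀ u v, ⟪T u, v⟫_ℝ = ⟪u, T v⟫_ℝ) : tr (onFun T) = onFun T := by
  symm; apply tr_unique; intro f g
  rw [dotProduct_comm, dot_onFun, ← hT, real_inner_comm, ← dot_onFun]

end L2

/-! ## §3  The torus translations: `tr τ_a = τ_{−a}` -/

section Translate

open BalabanImbrieJaffe1984to88.BIJ85AxialPropagator411 (BondSpace)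
open B6TranslateTorusV1 (TB TB_apply)

variable {P : Params}

/-- **`tr τ_a = τ_{−a}`** (a translation of the torus is a permutation of the bonds). [cite: Balaban1983RegularityDecay, p.572 («T_η … with periodic conditions»), dictionary] -/
theorem tr_TB (a : Site P 0) : tr (TB a) = TB (-a) := by
  symm; apply tr_unique; intro f g
  simp only [dotProduct, TB_apply]
  have h := Fintype.sum_equiv (PBond.translateEquiv a) (fun b => f b * g (b.translate a)) (fun b => f (b.translate (-a)) * g b) ?_
  · exact h.symm
  · intro b
    show f b * g (b.translate a) = f ((b.translate a).translate (-a)) * g (b.translate a)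
    rw [PBond.translate_translate, add_neg_cancel]
    cases b; simp [PBond.translate]

/-- `tr (τ_{−a}Xτ_a) = τ_{−a}(tr X)τ_a`. [cite: Balaban1984PropagatorsII, (2.19) p.226, dictionary] -/
theorem tr_conj (a : Site P 0) (A : Module.End ℝ (PBond P 0 → ℝ)) : tr (TB (-a) * A * TB a) = TB (-a) * tr A * TB a := by
  rw [tr_mul, tr_mul, tr_TB, tr_TB, neg_neg, mul_assoc]

end Translate

/-! ## §4  The cube: every operator of the construction is symmetric or has a named transpose -/

section Cube

open B6GlobalChartV1 (PV domT blkV1)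
open B6SectAOperatorsV1 (dE dsE dcE dcsE QE aE QsE RE BondIdx inner_dE_left inner_dsE_left inner_dcsE_left inner_QsE_left inner_aE_left inner_RE_left)
open B6SectAVectorModelV1 (deltaAE GE deltaAE_comp_GE)
open B6Prop25TwoScaleCensus (TSIdx)
open B6AgreeLapV1Chart (cB eB posV transplant_eB_eq onFun_comp onFun_id onFun_add)
open B6MultiLevelBoxOperator (N0)
open B6MultiLevelTorusOperator (TDomains)
open B6Cover236MultiLevelBlocks (cubes)
open B6Eq238MultiLevelTorus (svec)
open B6Geom246MultiLevelTorus (geomT)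
open B6TranslateV1 (trV)
open B6TranslateTorusV1 (vch TB TB_mul_TB_neg TB_neg_mul_TB)
open B6Prop26KLevelSkeletonV1 (hB ST)
open B6Prop26KLevelSkeletonV2 (SbigT)
open B6CubeWindowV1 (tC sc x0 hx0 hfit wC hch Placed Gl Ml Pl GlC MlC PlC j0 j0_hj eC hagree_cube hinvl_cube)
open B6AgreeQaQV1Chart (NearB)
open B6MemberOfCubeV1 (bare)
open B6Eq292MemberTorusV1 (EC NC zC cfC c0C hdec_cube)
open B6CubeMoutV1 (outLoc_Ml_hB)
open B6SectCTwoScaleV1Lattice (isLattice positive)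
open B6SectCPositivity (G_symm)
open B6SectCOperators.TwoScaleData (lapV_symm)
open B6Eq2112Assembly (starProjection_symm_form)
open B6BlockDecayGDivBridgeV1 (adjoint_Dop)

variable {d ℓ : ℕ} {hd : 1 ≤ d + 1} {hL : Odd (ℓ + 1) ∧ 1 < ℓ + 1} {a₀ a₁ : ℝ} {m K : ℕ} {Mh k R : ℕ} {P' : Fin (d + 1) → ℕ}
variable (hN : ∀ μ, N0 ℓ Mh k P' μ = (PV d ℓ m K hd hL).sitesPerDir 0) {D : TDomains d ℓ Mh k P' R} (hk : k ≤ m + K)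
  (hMh1 : 1 ≤ Mh) (hP4 : ∀ μ, 4 ≤ P' μ) {a : ℕ} (hMha : Mh = (ℓ + 1) ^ a) (c : ↥(cubes D.toDomains)) (ha : a₀ ≤ a₁)

/-- **`G_□` OF THE MEMBER IS SYMMETRIC** (`G = Δ_a⁻¹`, `Δ_a` symmetric; p22's `G_symm` with the member's lattice/positivity structure, `a₀ > 0`).
[cite: Balaban1984PropagatorsII, (2.22) p.226, (2.90) p.239] -/
theorem tr_onFun_G (ha₀ : 0 < a₀) (t : TSIdx d (ℓ + 1) hd hL a₀ a₁) : tr (onFun t.D.G) = onFun t.D.G :=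
  tr_onFun_of_symm (G_symm (isLattice t.Λ' t.hc t.hjP (t.w_pos ha₀)) (positive t.Λ' t.hc t.hjP t.w))

/-- **`Δ_□ + Q*a_□Q` OF THE MEMBER IS SYMMETRIC**. [cite: Balaban1984PropagatorsII, (2.19) p.226, (2.90) p.239] -/
theorem tr_onFun_M (ha₀ : 0 < a₀) (t : TSIdx d (ℓ + 1) hd hL a₀ a₁) :
    tr (onFun (t.D.lapV + LinearMap.adjoint t.D.Q ∘ₗ t.D.a ∘ₗ t.D.Q)) = onFun (t.D.lapV + LinearMap.adjoint t.D.Q ∘ₗ t.D.a ∘ₗ t.D.Q) := by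
  have hL' : t.D.IsLattice := isLattice t.Λ' t.hc t.hjP (t.w_pos ha₀)
  refine tr_onFun_of_symm fun u v => ?_
  simp only [LinearMap.add_apply, LinearMap.coe_comp, Function.comp_apply, inner_add_left, inner_add_right]
  rw [lapV_symm hL', LinearMap.adjoint_inner_left, hL'.a_symm, LinearMap.adjoint_inner_right]

/-- **`∂P_□∂*` OF THE MEMBER IS SYMMETRIC** (`P = I − R`, `R` an orthogonal projection, `∂*` the adjoint of `∂`). [cite: Balaban1984PropagatorsII, (2.10) p.225, (2.19) p.226, (2.90) p.239] -/
theorem tr_onFun_P (ha₀ : 0 < a₀) (t : TSIdx d (ℓ + 1) hd hL a₀ a₁) :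
    tr (onFun (t.D.grad ∘ₗ t.D.P ∘ₗ t.D.dv)) = onFun (t.D.grad ∘ₗ t.D.P ∘ₗ t.D.dv) := by
  have hL' : t.D.IsLattice := isLattice t.Λ' t.hc t.hjP (t.w_pos ha₀)
  refine tr_onFun_of_symm fun u v => ?_
  simp only [LinearMap.coe_comp, Function.comp_apply]
  exact starProjection_symm_form (t.D.NQ.map t.D.lap) t.D.P (fun _ => rfl) t.D.grad t.D.dv hL'.grad_adj u v

/-- **`Q*a_□Q` OF THE MEMBER IS SYMMETRIC**. [cite: Balaban1984PropagatorsII, (2.18)–(2.19) p.226, (2.90) p.239] -/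
theorem tr_onFun_QaQ (ha₀ : 0 < a₀) (t : TSIdx d (ℓ + 1) hd hL a₀ a₁) :
    tr (onFun (LinearMap.adjoint t.D.Q ∘ₗ t.D.a ∘ₗ t.D.Q)) = onFun (LinearMap.adjoint t.D.Q ∘ₗ t.D.a ∘ₗ t.D.Q) := by
  have hL' : t.D.IsLattice := isLattice t.Λ' t.hc t.hjP (t.w_pos ha₀)
  refine tr_onFun_of_symm fun u v => ?_
  simp only [LinearMap.coe_comp, Function.comp_apply]
  rw [LinearMap.adjoint_inner_left, hL'.a_symm, LinearMap.adjoint_inner_right]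

/-- **`∇_λ† = ∇_λ*` AND `(∇_λ*)† = ∇_λ`**: `tr (onFun ∇_λ) = onFun ∇_λ*`, `tr (onFun ∇_λ*) = onFun ∇_λ` (p02's `adjoint_Dop`).
[cite: Balaban1984PropagatorsI, (1.4) p.18, (1.89) p.33; Balaban1984PropagatorsII, (2.92) p.239] -/
theorem tr_onFun_Dl (t : TSIdx d (ℓ + 1) hd hL a₀ a₁) (lam : Fin (d + 1)) (b : Bool) :
    tr (onFun (if b then t.Dl lam else t.Dla lam)) = onFun (if (!b) then t.Dl lam else t.Dla lam) := by
  cases b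
  · simp only [Bool.not_false, ite_true, Bool.false_eq_true, ite_false]
    rw [tr_onFun]
    congr 1
    have h := adjoint_Dop (P := t.P) ((((ℓ + 1 : ℕ) : ℝ)) ^ t.j) lam
    have h' := congrArg LinearMap.adjoint h
    rw [LinearMap.adjoint_adjoint] at h'
    exact h'.symm
  · simp only [Bool.not_true, ite_true, Bool.false_eq_true, ite_false]
    rw [tr_onFun]
    congr 1
    exact adjoint_Dop (P := t.P) ((((ℓ + 1 : ℕ) : ℝ)) ^ t.j) lam

/-- `tr G_□^{ch} = G_□^{ch}` (chart frame). [cite: Balaban1984PropagatorsII, (2.90)–(2.91) p.239] -/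
theorem tr_GlC (ha₀ : 0 < a₀) (hpl : Placed ℓ k P' c.1) (w : BondIdx (domT hN D hk) → ℝ) (cf : ℝ) :
    tr (GlC hN hk hMh1 hP4 hMha c ha hpl (wC hN hk c w) cf) = GlC hN hk hMh1 hP4 hMha c ha hpl (wC hN hk c w) cf := by
  unfold GlC B6GlobalChartV1.GlV1
  rw [tr_smul, tr_transplant, tr_onFun_G ha₀]

/-- `tr M_□^{ch} = M_□^{ch}`. [cite: Balaban1984PropagatorsII, (2.90)–(2.91) p.239] -/
theorem tr_MlC (ha₀ : 0 < a₀) (hpl : Placed ℓ k P' c.1) (w : BondIdx (domT hN D hk) → ℝ) (cf : ℝ) :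
    tr (MlC hN hk hMh1 hP4 hMha c ha hpl (wC hN hk c w) cf) = MlC hN hk hMh1 hP4 hMha c ha hpl (wC hN hk c w) cf := by
  unfold MlC
  rw [tr_smul, tr_transplant, tr_onFun_M ha₀]

/-- `tr P_□^{ch} = P_□^{ch}`. [cite: Balaban1984PropagatorsII, (2.90)–(2.91) p.239] -/
theorem tr_PlC (ha₀ : 0 < a₀) (hpl : Placed ℓ k P' c.1) (w : BondIdx (domT hN D hk) → ℝ) (cf : ℝ) :
    tr (PlC hN hk hMh1 hP4 hMha c ha hpl (wC hN hk c w) cf) = PlC hN hk hMh1 hP4 hMha c ha hpl (wC hN hk c w) cf := by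
  unfold PlC
  rw [tr_smul, tr_transplant, tr_onFun_P ha₀]

/-- **`tr G_□ = G_□`** on the global torus. [cite: Balaban1984PropagatorsII, (2.90)–(2.91) p.239, (2.22) p.226] -/
theorem tr_Gl (ha₀ : 0 < a₀) (hpl : Placed ℓ k P' c.1) (w : BondIdx (domT hN D hk) → ℝ) (cf : ℝ) :
    tr (Gl hN hk hMh1 hP4 hMha c ha hpl w cf) = Gl hN hk hMh1 hP4 hMha c ha hpl w cf := by
  unfold Gl; rw [tr_conj, tr_GlC hN hk hMh1 hP4 hMha c ha ha₀]

/-- **`tr M_□ = M_□`**. [cite: Balaban1984PropagatorsII, (2.90)–(2.91) p.239, (2.19) p.226] -/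
theorem tr_Ml (ha₀ : 0 < a₀) (hpl : Placed ℓ k P' c.1) (w : BondIdx (domT hN D hk) → ℝ) (cf : ℝ) :
    tr (Ml hN hk hMh1 hP4 hMha c ha hpl w cf) = Ml hN hk hMh1 hP4 hMha c ha hpl w cf := by
  unfold Ml; rw [tr_conj, tr_MlC hN hk hMh1 hP4 hMha c ha ha₀]

/-- **`tr P_□ = P_□`**. [cite: Balaban1984PropagatorsII, (2.90)–(2.91) p.239, (2.10) p.225] -/
theorem tr_Pl (ha₀ : 0 < a₀) (hpl : Placed ℓ k P' c.1) (w : BondIdx (domT hN D hk) → ℝ) (cf : ℝ) :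
    tr (Pl hN hk hMh1 hP4 hMha c ha hpl w cf) = Pl hN hk hMh1 hP4 hMha c ha hpl w cf := by
  unfold Pl; rw [tr_conj, tr_PlC hN hk hMh1 hP4 hMha c ha ha₀]

/-- **`tr N = N`** for the averaging partner `N = τ(s•ε(Q*a_□Q)ρ)τ`. [cite: Balaban1984PropagatorsII, (2.92) p.239 (line 2), (2.18) p.226] -/
theorem tr_NC (ha₀ : 0 < a₀) (hpl : Placed ℓ k P' c.1) (w : BondIdx (domT hN D hk) → ℝ) (cf : ℝ) :
    tr (NC hN hk hMh1 hP4 hMha c ha hpl w cf) = NC hN hk hMh1 hP4 hMha c ha hpl w cf := by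
  unfold NC
  rw [tr_conj, tr_smul, tr_transplant, tr_onFun_QaQ ha₀]

/-- **`tr E_{(λ,±)} = E_{(λ,∓)}`**: the transposes of the cube's first-order operators are the cube's first-order operators of the opposite orientation.
[cite: Balaban1984PropagatorsII, (2.92) p.239 (line 1); Balaban1984PropagatorsI, (1.89) p.33] -/
theorem tr_EC (hpl : Placed ℓ k P' c.1) (w : BondIdx (domT hN D hk) → ℝ) (cf : ℝ) (e : Fin (d + 1) × Bool) :
    tr (EC hN hk hMh1 hP4 hMha c ha hpl w cf e) = EC hN hk hMh1 hP4 hMha c ha hpl w cf (e.1, !e.2) := by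
  unfold EC
  rw [tr_conj, tr_transplant, tr_onFun_Dl]

/-- **THE LOCAL PART `∂*∂ + ∂∂* + Q*aQ` OF THE GLOBAL `Δ_a` IS SYMMETRIC**. [cite: Balaban1984PropagatorsII, (2.18)–(2.19) p.226] -/
theorem tr_onFun_localPart {Pm : Params} (Dm : B6SectADomainsV1.Domains Pm) (cf : ℝ) (w : BondIdx Dm → ℝ) :
    tr (onFun (dcsE (P := Pm) cf ∘ₗ dcE cf + dE cf ∘ₗ dsE cf + QsE Dm ∘ₗ aE Dm w ∘ₗ QE Dm)) =
      onFun (dcsE (P := Pm) cf ∘ₗ dcE cf + dE cf ∘ₗ dsE cf + QsE Dm ∘ₗ aE Dm w ∘ₗ QE Dm) := by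
  refine tr_onFun_of_symm fun u v => ?_
  simp only [LinearMap.add_apply, LinearMap.coe_comp, Function.comp_apply, inner_add_left, inner_add_right]
  have h1 : ⟪dcsE cf (dcE cf u), v⟫_ℝ = ⟪u, dcsE cf (dcE cf v)⟫_ℝ := by
    rw [inner_dcsE_left, ← real_inner_comm u, inner_dcsE_left, real_inner_comm]
  have h2 : ⟪dE cf (dsE cf u), v⟫_ℝ = ⟪u, dE cf (dsE cf v)⟫_ℝ := by
    rw [inner_dE_left, ← real_inner_comm u, inner_dE_left, real_inner_comm]
  have h3 : ⟪QsE Dm (aE Dm w (QE Dm u)), v⟫_ℝ = ⟪u, QsE Dm (aE Dm w (QE Dm v))⟫_ℝ := by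
    rw [inner_QsE_left, inner_aE_left, ← real_inner_comm u, inner_QsE_left, real_inner_comm]
  rw [h1, h2, h3]

/-! ## §5  The transposed cube identities -/

/-- **(hagreeT) FOR THE CUBE: `h_□·M = h_□·M_□`** — p38's `hagree_cube` transposed (`M`, `M_□` symmetric, `h_□·` symmetric).
[cite: Balaban1984PropagatorsII, (2.89)–(2.91) p.239, (2.19) p.226] -/
theorem hagreeT_cube (ha₀ : 0 < a₀) (hk2 : 2 ≤ k) (hM8 : 8 ≤ Mh) (hR2 : 2 * (ℓ + 1) ^ 2 ≤ R) (hpl : Placed ℓ k P' c.1)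
    (w : BondIdx (domT hN D hk) → ℝ) {cf : ℝ} (hcf : cf ≠ 0)
    (hband : ∀ i : BondIdx (domT hN (D.chart (svec ℓ k c.1.1 c.1.2)) hk), ((i.1.1 : ℕ) = j0 hMh1 hP4 c ∨ (i.1.1 : ℕ) = j0 hMh1 hP4 c + 1) →
      NearB (bare d ℓ hd hL (eC a c.1.1) 0 (j0 hMh1 hP4 c) (j0_hj hMh1 hP4 c a) ha) (x0 ℓ Mh k c.1) (4 * (ℓ + 1) ^ (j0 hMh1 hP4 c + 1)) i.1.1 i.1.2 →
      a₀ * ((((ℓ + 1 : ℕ) : ℝ)) ^ j0 hMh1 hP4 c) ^ (d + 1) ≤ wC hN hk c w i / (cf / (((ℓ + 1 : ℕ) : ℝ) ^ j0 hMh1 hP4 c)) ^ 2 ∧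
        wC hN hk c w i / (cf / (((ℓ + 1 : ℕ) : ℝ) ^ j0 hMh1 hP4 c)) ^ 2 ≤ a₁ * ((((ℓ + 1 : ℕ) : ℝ)) ^ j0 hMh1 hP4 c) ^ (d + 1)) :
    mulOp (hB hN D c) * onFun (dcsE (P := PV d ℓ m K hd hL) cf ∘ₗ dcE cf + dE cf ∘ₗ dsE cf +
        QsE (domT hN D hk) ∘ₗ aE (domT hN D hk) w ∘ₗ QE (domT hN D hk)) =
      mulOp (hB hN D c) * Ml hN hk hMh1 hP4 hMha c ha hpl w cf := by
  have h := congrArg tr (hagree_cube hN hk hMh1 hP4 hMha c ha hk2 hM8 hR2 hpl w hcf hband)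
  rw [tr_mul, tr_mul, tr_mulOp, tr_onFun_localPart, tr_Ml hN hk hMh1 hP4 hMha c ha ha₀] at h
  exact h

/-- **(hinvT) FOR THE CUBE: `h_□G_□(M_□ − P_□) = h_□`** — p38's `hinvl_cube` transposed. [cite: Balaban1984PropagatorsII, (2.90)–(2.91), (2.94) p.239] -/
theorem hinvT_cube (ha₀ : 0 < a₀) (hM8 : 8 ≤ Mh) (hR2 : 2 * (ℓ + 1) ^ 2 ≤ R) (hpl : Placed ℓ k P' c.1)
    (w : BondIdx (domT hN D hk) → ℝ) {cf : ℝ} (hcf : cf ≠ 0) :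
    mulOp (hB hN D c) * Gl hN hk hMh1 hP4 hMha c ha hpl w cf * (Ml hN hk hMh1 hP4 hMha c ha hpl w cf - Pl hN hk hMh1 hP4 hMha c ha hpl w cf) =
      mulOp (hB hN D c) := by
  have h := congrArg tr (hinvl_cube hN hk hMh1 hP4 hMha c ha ha₀ hM8 hR2 hpl w hcf)
  rw [tr_mul, tr_mul, tr_mulOp, tr_sub, tr_Gl hN hk hMh1 hP4 hMha c ha ha₀, tr_Ml hN hk hMh1 hP4 hMha c ha ha₀,
    tr_Pl hN hk hMh1 hP4 hMha c ha ha₀, ← mul_assoc] at h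
  exact h

/-- **(hdecT) FOR THE CUBE: `M_□h_□ − h_□M_□ = (Σ_e E_ē·c_e − c₀) + Σ_k (h_□N − Nh_□)·z`** (`ē = (λ, ∓)`) — p38 gen 29's `hdec_cube` transposed: the INPUT-side
decomposition of the reversed commutator consumed by `…B6Ineq2134TransposeKLevelTorus.ineq2134T_kDiag_torus`.
[cite: Balaban1984PropagatorsII, (2.92) p.239 (lines 1–2), (2.90)–(2.91), (2.94) p.239] -/
theorem hdecT_cube (ha₀ : 0 < a₀) (hM8 : 8 ≤ Mh) (hR2 : 2 * (ℓ + 1) ^ 2 ≤ R) (hpl : Placed ℓ k P' c.1) (w : BondIdx (domT hN D hk) → ℝ) (cf : ℝ) :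
    Ml hN hk hMh1 hP4 hMha c ha hpl w cf * mulOp (hB hN D c) - mulOp (hB hN D c) * Ml hN hk hMh1 hP4 hMha c ha hpl w cf =
      (∑ e ∈ (Finset.univ : Finset (Fin (d + 1) × Bool)),
          EC hN hk hMh1 hP4 hMha c ha hpl w cf (e.1, !e.2) * mulOp (cfC hN hk hMh1 hP4 hMha c ha hpl w cf e) -
        mulOp (c0C hN hk hMh1 hP4 hMha c ha hpl w cf)) +
      ∑ _k ∈ ({()} : Finset Unit), (mulOp (hB hN D c) * NC hN hk hMh1 hP4 hMha c ha hpl w cf -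
        NC hN hk hMh1 hP4 hMha c ha hpl w cf * mulOp (hB hN D c)) * mulOp (zC hN hk hMh1 hP4 hMha c ha hpl w cf) := by
  have h := congrArg tr (hdec_cube hN hk hMh1 hP4 hMha c ha hM8 hR2 hpl w cf)
  rw [tr_sub, tr_mul, tr_mul, tr_mulOp, tr_Ml hN hk hMh1 hP4 hMha c ha ha₀, tr_add, tr_sub, tr_sum, tr_sum, tr_mulOp] at h
  simp only [tr_mul, tr_mulOp, tr_sub, tr_EC, tr_NC hN hk hMh1 hP4 hMha c ha ha₀] at h
  exact h

/-- **INPUT LOCALISATION OF `h_□M_□` OVER `□̃`** — p38's `outLoc_Ml_hB` transposed (the hypothesis `hMin` of `ineq2134T_kDiag_torus`).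
[cite: Balaban1984PropagatorsII, (2.91)–(2.92) p.239 (range of Δ, supp h_□ ⊂ □̃)] -/
theorem inLoc_hB_Ml (ha₀ : 0 < a₀) (hM8 : 8 ≤ Mh) (hR2 : 2 * (ℓ + 1) ^ 2 ≤ R) (hP5 : ∀ μ, 5 ≤ P' μ) (hpl : Placed ℓ k P' c.1)
    (w : BondIdx (domT hN D hk) → ℝ) (cf : ℝ)
    (hcfT : ∀ (e : Fin (d + 1) × Bool) (x : PBond (PV d ℓ m K hd hL) 0),
      cfC hN hk hMh1 hP4 hMha c ha hpl w cf e x ≠ 0 → blkV1 hN D x ∈ ST D hMh1 hP4 c)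
    (hc0T : ∀ x : PBond (PV d ℓ m K hd hL) 0, c0C hN hk hMh1 hP4 hMha c ha hpl w cf x ≠ 0 → blkV1 hN D x ∈ ST D hMh1 hP4 c) :
    InLoc (g := geomT D) (blkV1 hN D) (mulOp (hB hN D c) * Ml hN hk hMh1 hP4 hMha c ha hpl w cf) (SbigT D hMh1 hP4 c) := by
  have h := inLoc_tr_of_outLoc (g := geomT D) (blkV1 hN D) (outLoc_Ml_hB hN hk hMh1 hP4 hMha c ha hM8 hR2 hP5 hpl w cf hcfT hc0T)
  rw [tr_mul, tr_mulOp, tr_Ml hN hk hMh1 hP4 hMha c ha ha₀] at h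
  exact h

/-- **`Δ_aG = 1`** for the genuine global operators, read on bond functions — the left inverse the transposed walk starts from
(`…B6Eq291Transpose.leftFixedPointT`). [cite: Balaban1984PropagatorsII, (2.22) p.226, (2.141) p.247] -/
theorem onFun_deltaAE_mul_GE {Pm : Params} (Dm : B6SectADomainsV1.Domains Pm) {cf : ℝ} (hcf : cf ≠ 0) {w : BondIdx Dm → ℝ} (hw : ∀ i, 0 < w i) :
    onFun (deltaAE Dm cf w) * onFun (GE Dm hcf hw) = 1 := by
  rw [Module.End.mul_eq_comp, ← onFun_comp, deltaAE_comp_GE, onFun_id, Module.End.one_eq_id]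

end Cube

end Literature.MathematicalPhysics.QuantumFieldTheory.Balaban1983to89.B6OpTransposeV1

end
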